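import Summits.BirchSwinnertonDyer.Rank1Residual.Additive.TwistPartnerRigidity
import HarnessLib

/-!
# THE FORCED TWIST PARTNER, WRITTEN OUT: an explicit `Φ_{x,χ,ã} : ℚ → ℚ_p` which is `1`-periodic and
# solves `Φ = S + (ã/p)·Φ(p·)` on ALL of `ℚ`; with `U_p x = 0` it IS an ordinary twist partner, so
# `HasOrdinaryTwistPartner`-type inputs reduce to ONE boundedness statement about ONE explicit
# function (cell `b2b-bsdres`, sub-cell additive-p2 = X3♯(G-ord) / X4♯(G-ord), gen 23; sequel of
# `TwistPartnerRigidity.lean`)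

HONEST FRAMING (cell `b2b-bsdres`, run/shared/lean/b2b/bsd-rank1-residual/, verbatim in every
file): the goal of the cell is to DELETE the COMBINATION-SHAPED residual classes of the
Birch–Swinnerton-Dyer formula for ALL analytic-rank `≤ 1` elliptic curves over `ℚ` — "full BSD
formula for every rank `≤ 1` curve in class `C`" assembled STRICTLY from published theorems — so
that the rank-`≤ 1` remainder becomes exactly the CONSTRUCTION-SHAPED classes, which are TYPED
(missing-input `Prop`s), NOT attempted. This is not "finishing BSD". Sub-cell additive-p2: the
classes X3♯(G-ord) / X4♯(G-ord) are CONSTRUCTION-SHAPED and stay so; labels / RESIDUAL-MAP marks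
UNCHANGED; nothing is booked. FOUR auxiliary DEFINITIONS (explicit formulas — data written out,
nothing asserted, no named fact, no conjecture node) and theorems.

## What

`TwistPartnerRigidity.lean` showed that an ordinary twist partner `(Φ, ã)` of `(x, χ)` — `Φ`
`1`-periodic, `x = τ_{χ⁻¹}Φ`, `∑_d Φ(· + d/p) = ãΦ(p·)` — satisfies `Φ(s) = S(s) + (ã/p)Φ(ps)` with the
source `S = (χ(−1)/p)·τ_χ x`, and is unique for its unit. Here the solution is WRITTEN DOWN on all of
`ℚ` (Mazur–Tate–Teitelbaum's `p`-stabilisation run backwards from `x`):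

* §1 `source χ x` (`S`), `tail χ x ã` (the stationary solution at `p`-integral arguments:
  `Ψ(t) = (1 − c^N)⁻¹∑_{j<N} c^j S(p^j t)`, `c = ã/p`, `N = φ(den t)` — Euler: `den t ∣ p^N − 1`, so
  `S(p^N t) = S(t)`), `approx χ x ã s n = ∑_{j<n} c^j S(p^j s) + cⁿΨ(pⁿs)` and the FORCED PARTNER
  `forced χ x ã s := approx χ x ã s (v_p(den s))`;
* §2 `tail_eq_source_add` (stationarity `Ψ(t) = S(t) + cΨ(pt)` for `p ∤ den t`),
  `approx_succ_eq_of_not_dvd` / `approx_eq_of_le` (the approximants are constant from the first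
  `p`-integral level on), `forced_add_one` (`1`-periodicity) and **`forced_eq_source_add_mul`**: for
  EVERY `s ∈ ℚ`, `Φ(s) = S(s) + (ã/p)·Φ(ps)` — no hypothesis on `x` beyond `1`-periodicity, none on
  `χ`, only `‖ã‖ = 1`;
* sequel `TwistPartnerForcedReduction.lean` (same gen): conversely a `1`-periodic solution of the
  recursion IS a partner once `U_p x = 0`; THE REDUCTION `CensusX43.HasOrdinaryTwistPartner χ f ↔
  U_p[·]⁺_f = 0 ∧ ∃ ã unit, forced χ [·]⁺_f ã bounded`; on an ADDITIVE row the `U_p` clause is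
  automatic, and ONE unit with a bounded forced partner PRODUCES the E-normalised tame branch
  `IsTameBranchOf f_E p (ι∘χ) ã B` — the defect-3/4/6 analytic object from ONE boundedness statement
  about ONE explicit function of `E`'s own symbols; ENGINE RECIPE `μ(a + pⁿℤ_p) = ã⁻ⁿχ̄(a)·forced(a/pⁿ)`.

References: B. Mazur, J. Tate, J. Teitelbaum, Invent. Math. 84 (1986) §I.8, §I.10 (10.1)–(10.2)
[MazurTateTeitelbaum1986Invent]; A. O. L. Atkin, W. Li, Invent. Math. 48 (1978) §3 [AtkinLi1978];
D. Delbourgo, Compositio Math. 113 (1998) §1.5 [Delbourgo1998].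
-/

noncomputable section

open scoped Classical MatrixGroups ModularForm

open CongruenceSubgroup

namespace Summit.BirchSwinnertonDyer.Rank1Residual.Additive

open Literature.NumberTheory.EllipticCurves Literature.NumberTheory.EllipticCurves.ModularForms
  Literature.NumberTheory.EllipticCurves.Rank1Residual

namespace TwistPartner

/-! ### §1 The explicit formulas -/

section Defs

variable {p : ℕ} [hp : Fact p.Prime]

/-- **The source** `S_{x,χ}(s) := (χ(−1)/p)·τ_χ x(s) = (χ(−1)/p)·∑_{b mod p} χ(b)·x(s + b/p)` of the
functional equation `Φ = S + (ã/p)Φ(p·)` of an ordinary twist partner (`TwistPartner.eq_source_add_mul`).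
Data; nothing asserted. [cite: MazurTateTeitelbaum1986Invent, §I.8] -/
def source (χ : MulChar (ZMod p) ℚ_[p]) (x : ℚ → ℚ_[p]) (s : ℚ) : ℚ_[p] :=
  χ (-1) / p * CensusX43.twist χ x s

/-- **The stationary tail** at a `p`-INTEGRAL argument `t` (`p ∤ den t`):
`Ψ(t) := (1 − (ã/p)^N)⁻¹ · ∑_{j<N} (ã/p)^j · S(p^j t)` with `N = φ(den t)` (Euler: `den t ∣ p^N − 1`,
so `p^N t ≡ t (mod ℤ)` and the recursion closes up). Data; nothing asserted.
[cite: MazurTateTeitelbaum1986Invent, §I.10 (10.1)] -/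
def tail (χ : MulChar (ZMod p) ℚ_[p]) (x : ℚ → ℚ_[p]) (ã : ℚ_[p]) (t : ℚ) : ℚ_[p] :=
  (1 - (ã / p) ^ Nat.totient t.den)⁻¹ *
    ∑ j ∈ Finset.range (Nat.totient t.den), (ã / p) ^ j * source χ x ((p : ℚ) ^ j * t)

/-- **The level-`n` approximant** `F(s, n) := ∑_{j<n} (ã/p)^j S(p^j s) + (ã/p)ⁿ Ψ(pⁿ s)` (constant in
`n` from the first `p`-integral level of `s` on, `approx_eq_of_le`). Data; nothing asserted.
[cite: MazurTateTeitelbaum1986Invent, §I.10 (10.1)] -/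
def approx (χ : MulChar (ZMod p) ℚ_[p]) (x : ℚ → ℚ_[p]) (ã : ℚ_[p]) (s : ℚ) (n : ℕ) : ℚ_[p] :=
  ∑ j ∈ Finset.range n, (ã / p) ^ j * source χ x ((p : ℚ) ^ j * s) +
    (ã / p) ^ n * tail χ x ã ((p : ℚ) ^ n * s)

/-- **THE FORCED TWIST PARTNER** `Φ_{x,χ,ã}(s) := F(s, v_p(den s))` — the unique `1`-periodic solution
of `Φ = S_{x,χ} + (ã/p)Φ(p·)` on `ℚ` (`forced_eq_source_add_mul`, `TwistPartner.partner_unique`); for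
`x = [·]⁺_{f_E}` on a defect-3/4/6 row and the right unit `ã` it is, in print, the `Ω⁺_{f_E}`-normalised
symbol of Delbourgo's `p`-ordinary newform `f̃ = f_E ⊗ ε̄` (Mazur–Tate–Teitelbaum's `p`-stabilisation
run backwards). Data; nothing asserted. [cite: MazurTateTeitelbaum1986Invent, §I.10 (10.1)]
[cite: Delbourgo1998, §1.5] -/
def forced (χ : MulChar (ZMod p) ℚ_[p]) (x : ℚ → ℚ_[p]) (ã : ℚ_[p]) (s : ℚ) : ℚ_[p] :=
  approx χ x ã s (s.den.factorization p)

end Defs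

/-! ### §2 Periodicity and the recursion on all of `ℚ` -/

section Recursion

variable {p : ℕ} [hp : Fact p.Prime] {χ : MulChar (ZMod p) ℚ_[p]} {x : ℚ → ℚ_[p]} {ã : ℚ_[p]}

/-- The source is `1`-periodic (by integers) when `x` is. [folklore] -/
theorem source_add_intCast (hper : ∀ s, x (s + 1) = x s) (s : ℚ) (z : ℤ) :
    source χ x (s + z) = source χ x s := by
  simp only [source, CensusX43.twist]
  congr 1
  refine Finset.sum_congr rfl fun b _ ↦ ?_
  rw [add_right_comm, apply_add_intCast_of_periodic hper]

/-- `den(p·t) = den t` when `p ∤ den t`. [folklore] -/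
theorem den_natCast_mul_of_not_dvd {t : ℚ} (ht : ¬ p ∣ t.den) : ((p : ℚ) * t).den = t.den := by
  have hcop : Nat.Coprime ((p : ℤ) * t.num).natAbs (t.den : ℤ).natAbs := by
    rw [Int.natAbs_mul, Int.natAbs_natCast, Int.natAbs_natCast]
    exact Nat.Coprime.mul_left ((Nat.Prime.coprime_iff_not_dvd hp.out).mpr ht) t.reduced
  have h := Rat.den_div_eq_of_coprime (a := (p : ℤ) * t.num) (b := (t.den : ℤ))
    (by exact_mod_cast t.den_pos) hcop
  have heq : (((p : ℤ) * t.num : ℤ) : ℚ) / ((t.den : ℤ) : ℚ) = (p : ℚ) * t := by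
    push_cast
    rw [mul_div_assoc, Rat.num_div_den]
  rw [heq] at h
  exact_mod_cast h

/-- `den(p^j·t) = den t` and `p ∤ den(p^j t)` when `p ∤ den t`. [folklore] -/
theorem den_pow_mul_of_not_dvd {t : ℚ} (ht : ¬ p ∣ t.den) (j : ℕ) :
    (((p : ℚ) ^ j * t).den = t.den) := by
  induction j with
  | zero => rw [pow_zero, one_mul]
  | succ j ih =>
    rw [pow_succ', mul_assoc, den_natCast_mul_of_not_dvd (by rw [ih]; exact ht), ih]

/-- Euler at a `p`-integral argument: `p^{φ(den t)}·t = t + z` for an integer `z`. [folklore] -/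
theorem exists_pow_totient_mul_eq_add {t : ℚ} (ht : ¬ p ∣ t.den) :
    ∃ z : ℤ, (p : ℚ) ^ Nat.totient t.den * t = t + z := by
  have hcop : Nat.Coprime p t.den := (Nat.Prime.coprime_iff_not_dvd hp.out).mpr ht
  have heul : p ^ Nat.totient t.den ≡ 1 [MOD t.den] := Nat.ModEq.pow_totient hcop
  have h1le : 1 ≤ p ^ Nat.totient t.den := Nat.one_le_pow _ _ hp.out.pos
  obtain ⟨q, hq⟩ : t.den ∣ p ^ Nat.totient t.den - 1 := (Nat.modEq_iff_dvd' h1le).mp heul.symm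
  refine ⟨q * t.num, ?_⟩
  have hpow : ((p : ℚ) ^ Nat.totient t.den) = 1 + t.den * q := by
    have h : p ^ Nat.totient t.den = 1 + t.den * q := by omega
    exact_mod_cast h
  rw [hpow]
  push_cast
  linear_combination (q : ℚ) * Rat.den_mul_eq_num t

/-- **Stationarity of the tail**: for `p ∤ den t`, `Ψ(t) = S(t) + (ã/p)·Ψ(pt)` (the recursion closes
up because `S(p^N t) = S(t)`, `N = φ(den t)`). [cite: MazurTateTeitelbaum1986Invent, §I.10 (10.1)] -/
theorem tail_eq_source_add (hã : ‖ã‖ = 1) (hper : ∀ s, x (s + 1) = x s) {t : ℚ}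
    (ht : ¬ p ∣ t.den) :
    tail χ x ã t = source χ x t + ã / p * tail χ x ã (p * t) := by
  have hNp : ((p : ℚ) * t).den = t.den := den_natCast_mul_of_not_dvd ht
  have hcN : (1 - (ã / (p : ℚ_[p])) ^ Nat.totient t.den) ≠ 0 := by
    intro h0
    have h1 : (ã / (p : ℚ_[p])) ^ Nat.totient t.den = 1 := by linear_combination -h0
    have hN1 : 1 ≤ Nat.totient t.den := Nat.totient_pos.mpr t.den_pos
    have h2 : ‖ã / (p : ℚ_[p])‖ ^ Nat.totient t.den = 1 := by rw [← norm_pow, h1, norm_one]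
    exact norm_div_natCast_ne_one hã
      ((pow_eq_one_iff_of_nonneg (norm_nonneg _) (by omega)).mp h2)
  -- `S(p^N t) = S(t)`
  obtain ⟨z, hz⟩ := exists_pow_totient_mul_eq_add (p := p) ht
  have hSN : source χ x ((p : ℚ) ^ Nat.totient t.den * t) = source χ x t := by
    rw [hz, source_add_intCast hper]
  -- the telescoping identity `c·B + S(t) = A + c^N·S(t)`, `c = ã/p`
  have key : ∑ j ∈ Finset.range (Nat.totient t.den + 1),
      (ã / (p : ℚ_[p])) ^ j * source χ x ((p : ℚ) ^ j * t) =
      ∑ j ∈ Finset.range (Nat.totient t.den), (ã / (p : ℚ_[p])) ^ j * source χ x ((p : ℚ) ^ j * t) +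
        (ã / (p : ℚ_[p])) ^ Nat.totient t.den * source χ x t := by
    rw [Finset.sum_range_succ, hSN]
  rw [Finset.sum_range_succ', pow_zero, pow_zero, one_mul, one_mul] at key
  have key' : ∑ j ∈ Finset.range (Nat.totient t.den),
      (ã / (p : ℚ_[p])) ^ (j + 1) * source χ x ((p : ℚ) ^ (j + 1) * t) =
      ã / p * ∑ j ∈ Finset.range (Nat.totient t.den),
        (ã / (p : ℚ_[p])) ^ j * source χ x ((p : ℚ) ^ (j + 1) * t) := by
    rw [Finset.mul_sum]
    refine Finset.sum_congr rfl fun j _ ↦ ?_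
    rw [pow_succ]; ring
  rw [key'] at key
  -- unfold both tails
  have hR : ∑ j ∈ Finset.range (Nat.totient t.den),
      (ã / (p : ℚ_[p])) ^ j * source χ x ((p : ℚ) ^ j * ((p : ℚ) * t)) =
      ∑ j ∈ Finset.range (Nat.totient t.den),
        (ã / (p : ℚ_[p])) ^ j * source χ x ((p : ℚ) ^ (j + 1) * t) := by
    refine Finset.sum_congr rfl fun j _ ↦ ?_
    rw [pow_succ, mul_assoc]
  rw [tail, tail, hNp, hR]
  apply mul_left_cancel₀ hcN
  rw [← mul_assoc, mul_inv_cancel₀ hcN, one_mul, mul_add, ← mul_assoc, ← mul_assoc,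
    mul_comm (1 - _) (ã / (p : ℚ_[p])), mul_assoc (ã / (p : ℚ_[p])), mul_inv_cancel₀ hcN, mul_one]
  linear_combination (-1 : ℚ_[p]) * key

/-- The algebraic step `S(s) + (ã/p)·F(ps, n) = F(s, n+1)` (no hypothesis). [folklore] -/
theorem source_add_mul_approx (s : ℚ) (n : ℕ) :
    source χ x s + ã / p * approx χ x ã (p * s) n = approx χ x ã s (n + 1) := by
  simp only [approx]
  rw [Finset.sum_range_succ', pow_zero, pow_zero, one_mul, one_mul, mul_add, Finset.mul_sum]
  have h1 : ∀ j ∈ Finset.range n,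
      ã / p * ((ã / p) ^ j * source χ x ((p : ℚ) ^ j * (p * s))) =
        (ã / p) ^ (j + 1) * source χ x ((p : ℚ) ^ (j + 1) * s) := by
    intro j _
    rw [pow_succ, pow_succ]; ring_nf
  have h2 : ã / p * ((ã / p) ^ n * tail χ x ã ((p : ℚ) ^ n * (p * s))) =
      (ã / p) ^ (n + 1) * tail χ x ã ((p : ℚ) ^ (n + 1) * s) := by
    rw [pow_succ, pow_succ, show (p : ℚ) ^ n * (p * s) = (p : ℚ) ^ n * p * s by ring]; ring
  rw [Finset.sum_congr rfl h1, h2]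
  ring

/-- One stationary step of the approximants: if `p ∤ den(pⁿ s)` then `F(s, n+1) = F(s, n)`. [folklore] -/
theorem approx_succ_eq_of_not_dvd (hã : ‖ã‖ = 1) (hper : ∀ s, x (s + 1) = x s) (s : ℚ) {n : ℕ}
    (hn : ¬ p ∣ ((p : ℚ) ^ n * s).den) : approx χ x ã s (n + 1) = approx χ x ã s n := by
  simp only [approx]
  rw [Finset.sum_range_succ, tail_eq_source_add hã hper hn, pow_succ,
    show (p : ℚ) * ((p : ℚ) ^ n * s) = (p : ℚ) ^ n * p * s by ring]
  ring

/-- The approximants are constant from any `p`-integral level on. [folklore] -/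
theorem approx_eq_of_le (hã : ‖ã‖ = 1) (hper : ∀ s, x (s + 1) = x s) (s : ℚ) {n₀ : ℕ}
    (hn₀ : ¬ p ∣ ((p : ℚ) ^ n₀ * s).den) {n : ℕ} (hn : n₀ ≤ n) :
    approx χ x ã s n = approx χ x ã s n₀ := by
  induction n, hn using Nat.le_induction with
  | base => rfl
  | succ n hn ih =>
    rw [← ih, approx_succ_eq_of_not_dvd hã hper s]
    rw [show (p : ℚ) ^ n * s = (p : ℚ) ^ (n - n₀) * ((p : ℚ) ^ n₀ * s) by
      rw [← mul_assoc, ← pow_add, Nat.sub_add_cancel hn], den_pow_mul_of_not_dvd hn₀]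
    exact hn₀

/-- **The first `p`-integral level of `s` is `v_p(den s)`**: `p ∤ den(p^{v_p(den s)}·s)`. Indeed with
`den s = p^k·m`, `p ∤ m`, `m·(p^k s) = num s ∈ ℤ`, so `den(p^k s) ∣ m`. [folklore] -/
theorem not_dvd_den_pow_factorization_mul (s : ℚ) :
    ¬ p ∣ ((p : ℚ) ^ (s.den.factorization p) * s).den := by
  set k := s.den.factorization p with hk
  set m := s.den / p ^ k with hm
  have hden : p ^ k * m = s.den := Nat.ordProj_mul_ordCompl_eq_self s.den p
  have hcop : Nat.Coprime p m := Nat.coprime_ordCompl hp.out s.den_nz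
  have hm0 : 0 < m := Nat.pos_of_ne_zero fun h ↦ s.den_nz (by rw [← hden, h, mul_zero])
  -- `p^k s = num / m`
  have heq : (p : ℚ) ^ k * s = (s.num : ℚ) / (m : ℚ) := by
    have h := Rat.mul_den_eq_num s
    rw [← hden] at h
    push_cast at h
    have hm0' : (m : ℚ) ≠ 0 := Nat.cast_ne_zero.mpr hm0.ne'
    field_simp
    linear_combination h
  have hdvd : (((p : ℚ) ^ k * s).den : ℤ) ∣ (m : ℤ) := by
    rw [heq, show ((s.num : ℚ) / (m : ℚ)) = Rat.divInt s.num m by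
      rw [Rat.divInt_eq_div]; push_cast; rfl]
    exact Rat.den_dvd s.num m
  have hdvd' : ((p : ℚ) ^ k * s).den ∣ m := by exact_mod_cast hdvd
  intro hpd
  exact (Nat.Prime.coprime_iff_not_dvd hp.out).mp hcop (dvd_trans hpd hdvd')

/-- **`1`-periodicity of the forced partner.** [folklore] -/
theorem forced_add_one (hper : ∀ s, x (s + 1) = x s) (s : ℚ) :
    forced χ x ã (s + 1) = forced χ x ã s := by
  have hden : (s + 1).den = s.den := by exact_mod_cast Rat.add_intCast_den s 1
  simp only [forced, hden, approx]
  congr 1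
  · refine Finset.sum_congr rfl fun j _ ↦ ?_
    rw [mul_add, mul_one, show ((p : ℚ) ^ j) = ((p ^ j : ℤ) : ℚ) by push_cast; rfl,
      source_add_intCast hper]
  · congr 1
    set n := s.den.factorization p
    have hshift : (p : ℚ) ^ n * (s + 1) = (p : ℚ) ^ n * s + ((p ^ n : ℤ) : ℚ) := by push_cast; ring
    rw [hshift, tail, tail, Rat.add_intCast_den]
    congr 1
    refine Finset.sum_congr rfl fun j _ ↦ ?_
    rw [mul_add, show (p : ℚ) ^ j * ((p ^ n : ℤ) : ℚ) = ((p ^ j * p ^ n : ℤ) : ℚ) by push_cast; ring,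
      source_add_intCast hper]

/-- **THE RECURSION ON ALL OF `ℚ`**: for every `s`, `Φ(s) = S(s) + (ã/p)·Φ(ps)` for the forced partner
(`x` `1`-periodic, `‖ã‖ = 1`; nothing else). Both sides are approximants of `s` at `p`-integral
levels (`v_p(den s)` and `v_p(den(ps)) + 1`), hence equal (`approx_eq_of_le`).
[cite: MazurTateTeitelbaum1986Invent, §I.10 (10.1)–(10.2)] -/
theorem forced_eq_source_add_mul (hã : ‖ã‖ = 1) (hper : ∀ s, x (s + 1) = x s) (s : ℚ) :
    forced χ x ã s = source χ x s + ã / p * forced χ x ã (p * s) := by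
  simp only [forced]
  rw [source_add_mul_approx]
  set k := s.den.factorization p
  set k' := ((p : ℚ) * s).den.factorization p
  have hk : ¬ p ∣ ((p : ℚ) ^ k * s).den := not_dvd_den_pow_factorization_mul s
  have hk' : ¬ p ∣ ((p : ℚ) ^ (k' + 1) * s).den := by
    rw [pow_succ, mul_assoc]
    exact not_dvd_den_pow_factorization_mul ((p : ℚ) * s)
  rw [← approx_eq_of_le hã hper s hk (le_max_left k (k' + 1)),
    ← approx_eq_of_le hã hper s hk' (le_max_right k (k' + 1))]

end Recursion

end TwistPartner

end Summit.BirchSwinnertonDyer.Rank1Residual.Additive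

end
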